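import Summits.FinalStateConjecture.FinalStateConjecture.Theorems.SwallowTheDatumKerrShieldedSettlesStubKerrVacuumAux3
import Summits.FinalStateConjecture.FinalStateConjecture.Theorems.SwallowTheDatumKerrShieldedSettlesStubKerrVacuumAux7
import HarnessLib

/-!
# Kerr is Ricci-flat, algebra VII: the Koszul form and the Christoffel symbols of the Kerr metric

Support file for the stub `stub_kerrVacuum` of line `tapered-temporal-collar` (crux
`stmt-FinalStateConjecture-10054`): the Kerr metric `g_{M,a} = η + 2H ℓ ⊗ ℓ` in ingoing
Kerr–Schild Cartesian coordinates is Ricci-flat for all real `M, a, r₀` (`Kerr.isRicciFlat`).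
The pure algebra is done over six real variables `(a, M, x₁, x₂, r, c)`: at a point of the chart
with Kerr–Schild radius `r > 0` put `c = z/r` (`= cos θ`), so that the defining quartic of `r`
reads `x₂² = (r² + a²)(1 − c²) − x₁²`, and `Σ = r² + a²c²`, `H = M r/Σ`,
`ℓ = (1, (r x₁ + a x₂)/(r² + a²), (r x₂ − a x₁)/(r² + a²), c)`.
This part proves that the product-rule Koszul form `kzT` equals the closed form `kT` and the
Kerr–Schild formula `½ ∑_β g^{αβ} K(∂_μ,∂_ν,∂_β) = gamT α μ ν` for the Christoffel symbols (`ℓ` null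
and geodesic), 128 rational identities modulo the quartic. Kerr–Schild 1965, §2.

## References

* R. P. Kerr, *Gravitational field of a spinning mass as an example of algebraically special
  metrics*, Phys. Rev. Lett. 11 (1963) 237–238.
* R. P. Kerr, A. Schild, *A new class of vacuum solutions of the Einstein field equations*
  (1965), §§2–3.
* M. Visser, *The Kerr spacetime: a brief introduction*, arXiv:0706.0622, (32)–(36).
* B. O'Neill, *The geometry of Kerr black holes* (1995), Ch. 2, Thm. 2.6.1.
-/

set_option linter.dupNamespace false
set_option linter.unusedSimpArgs false
set_option linter.unusedTactic false
set_option linter.unreachableTactic false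
set_option linter.unnecessarySeqFocus false

noncomputable section

namespace Summit.FinalStateConjecture.FinalStateConjecture.Theorems.SwallowTheDatum.KerrShieldedSettles

namespace StubKerrVacuum

set_option maxRecDepth 8192 in
set_option maxHeartbeats 8000000 in
/-- The Koszul form `K(∂_0, ∂_ν, ∂_β)` of the Kerr metric equals its closed form.
[cite: KerrSchild1965, §3] -/
theorem kzT_eq_0 (a M x₁ x₂ r c : ℝ) (_hr : r ≠ 0) (_hS : r^2 + a^2*c^2 ≠ 0) (_hP : r^2 + a^2 ≠ 0)
    (_hC : x₂^2 = (r^2 + a^2)*(1 - c^2) - x₁^2) (ν β : Fin 4) :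
    kzT a M x₁ x₂ r c 0 ν β = kT a M x₁ x₂ r c 0 ν β := by
  fin_cases ν <;> fin_cases β <;>
    simp only [Fin.sum_univ_four, hT, ellT, kupT, etaT, sgnT, gT, ginvT, drT, dhT, dl1T,
      dl2T, dl3T, dlT, d2rT, d2hT, d2l1T, d2l2T, d2l3T, d2lT, dgT, kzT, d2gT, kT, kT00, kT01, kT02,
          kT03,
      kT11, kT12, kT13, kT22, kT23, kT33, fDfT, dfT, gamT, psiT, Fin.isValue, Fin.reduceEq, if_true,
      if_false] <;>
    (field_simp <;> ring_nf <;> (try simp only [xp16 _hC, xp15 _hC, xp14 _hC, xp13 _hC, xp12 _hC,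
        xp11 _hC,
      xp10 _hC, xp9 _hC, xp8 _hC, xp7 _hC, xp6 _hC, xp5 _hC, xp4 _hC, xp3 _hC,
          _hC]) <;> (try ring_nf))

set_option maxRecDepth 8192 in
set_option maxHeartbeats 8000000 in
/-- The Koszul form `K(∂_1, ∂_ν, ∂_β)` of the Kerr metric equals its closed form.
[cite: KerrSchild1965, §3] -/
theorem kzT_eq_1 (a M x₁ x₂ r c : ℝ) (_hr : r ≠ 0) (_hS : r^2 + a^2*c^2 ≠ 0) (_hP : r^2 + a^2 ≠ 0)
    (_hC : x₂^2 = (r^2 + a^2)*(1 - c^2) - x₁^2) (ν β : Fin 4) :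
    kzT a M x₁ x₂ r c 1 ν β = kT a M x₁ x₂ r c 1 ν β := by
  fin_cases ν <;> fin_cases β <;>
    simp only [Fin.sum_univ_four, hT, ellT, kupT, etaT, sgnT, gT, ginvT, drT, dhT, dl1T,
      dl2T, dl3T, dlT, d2rT, d2hT, d2l1T, d2l2T, d2l3T, d2lT, dgT, kzT, d2gT, kT, kT00, kT01, kT02,
          kT03,
      kT11, kT12, kT13, kT22, kT23, kT33, fDfT, dfT, gamT, psiT, Fin.isValue, Fin.reduceEq, if_true,
      if_false] <;>
    (field_simp <;> ring_nf <;> (try simp only [xp16 _hC, xp15 _hC, xp14 _hC, xp13 _hC, xp12 _hC,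
        xp11 _hC,
      xp10 _hC, xp9 _hC, xp8 _hC, xp7 _hC, xp6 _hC, xp5 _hC, xp4 _hC, xp3 _hC,
          _hC]) <;> (try ring_nf))

set_option maxRecDepth 8192 in
set_option maxHeartbeats 8000000 in
/-- The Koszul form `K(∂_2, ∂_ν, ∂_β)` of the Kerr metric equals its closed form.
[cite: KerrSchild1965, §3] -/
theorem kzT_eq_2 (a M x₁ x₂ r c : ℝ) (_hr : r ≠ 0) (_hS : r^2 + a^2*c^2 ≠ 0) (_hP : r^2 + a^2 ≠ 0)
    (_hC : x₂^2 = (r^2 + a^2)*(1 - c^2) - x₁^2) (ν β : Fin 4) :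
    kzT a M x₁ x₂ r c 2 ν β = kT a M x₁ x₂ r c 2 ν β := by
  fin_cases ν <;> fin_cases β <;>
    simp only [Fin.sum_univ_four, hT, ellT, kupT, etaT, sgnT, gT, ginvT, drT, dhT, dl1T,
      dl2T, dl3T, dlT, d2rT, d2hT, d2l1T, d2l2T, d2l3T, d2lT, dgT, kzT, d2gT, kT, kT00, kT01, kT02,
          kT03,
      kT11, kT12, kT13, kT22, kT23, kT33, fDfT, dfT, gamT, psiT, Fin.isValue, Fin.reduceEq, if_true,
      if_false] <;>
    (field_simp <;> ring_nf <;> (try simp only [xp16 _hC, xp15 _hC, xp14 _hC, xp13 _hC, xp12 _hC,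
        xp11 _hC,
      xp10 _hC, xp9 _hC, xp8 _hC, xp7 _hC, xp6 _hC, xp5 _hC, xp4 _hC, xp3 _hC,
          _hC]) <;> (try ring_nf))

set_option maxRecDepth 8192 in
set_option maxHeartbeats 8000000 in
/-- The Koszul form `K(∂_3, ∂_ν, ∂_β)` of the Kerr metric equals its closed form.
[cite: KerrSchild1965, §3] -/
theorem kzT_eq_3 (a M x₁ x₂ r c : ℝ) (_hr : r ≠ 0) (_hS : r^2 + a^2*c^2 ≠ 0) (_hP : r^2 + a^2 ≠ 0)
    (_hC : x₂^2 = (r^2 + a^2)*(1 - c^2) - x₁^2) (ν β : Fin 4) :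
    kzT a M x₁ x₂ r c 3 ν β = kT a M x₁ x₂ r c 3 ν β := by
  fin_cases ν <;> fin_cases β <;>
    simp only [Fin.sum_univ_four, hT, ellT, kupT, etaT, sgnT, gT, ginvT, drT, dhT, dl1T,
      dl2T, dl3T, dlT, d2rT, d2hT, d2l1T, d2l2T, d2l3T, d2lT, dgT, kzT, d2gT, kT, kT00, kT01, kT02,
          kT03,
      kT11, kT12, kT13, kT22, kT23, kT33, fDfT, dfT, gamT, psiT, Fin.isValue, Fin.reduceEq, if_true,
      if_false] <;>
    (field_simp <;> ring_nf <;> (try simp only [xp16 _hC, xp15 _hC, xp14 _hC, xp13 _hC, xp12 _hC,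
        xp11 _hC,
      xp10 _hC, xp9 _hC, xp8 _hC, xp7 _hC, xp6 _hC, xp5 _hC, xp4 _hC, xp3 _hC,
          _hC]) <;> (try ring_nf))

/-- **The Koszul form of the Kerr metric**: the defining combination of the first
derivatives of `g_{μν} = η_{μν} + 2Hℓ_μℓ_ν` equals the closed form `kT`. [cite: KerrSchild1965, §3]
-/
theorem kzT_eq (a M x₁ x₂ r c : ℝ) (_hr : r ≠ 0) (_hS : r^2 + a^2*c^2 ≠ 0) (_hP : r^2 + a^2 ≠ 0)
    (_hC : x₂^2 = (r^2 + a^2)*(1 - c^2) - x₁^2) (μ ν β : Fin 4) :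
    kzT a M x₁ x₂ r c μ ν β = kT a M x₁ x₂ r c μ ν β := by
  fin_cases μ
  exacts [kzT_eq_0 a M x₁ x₂ r c _hr _hS _hP _hC ν β, kzT_eq_1 a M x₁ x₂ r c _hr _hS _hP _hC ν β,
      kzT_eq_2 a M x₁ x₂ r c _hr _hS _hP _hC ν β, kzT_eq_3 a M x₁ x₂ r c _hr _hS _hP _hC ν β]

/-- The product-rule expression `d2gT i j μ ν` for `∂_i∂_j g_{μν}` is symmetric in `μ, ν`.
[folklore] -/
theorem d2gT_symm (a M x₁ x₂ r c : ℝ) (i j μ ν : Fin 4) :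
    d2gT a M x₁ x₂ r c i j μ ν = d2gT a M x₁ x₂ r c i j ν μ := by
  unfold d2gT; ring

set_option maxRecDepth 8192 in
set_option maxHeartbeats 8000000 in
/-- The Christoffel symbols `Γ^0_{μν}` of the Kerr metric: `½ ∑_β g^{0β} K(∂_μ, ∂_ν, ∂_β)` equals
the Kerr–Schild closed form. [cite: KerrSchild1965, §3] -/
theorem gamT_eq_0 (a M x₁ x₂ r c : ℝ) (_hr : r ≠ 0) (_hS : r^2 + a^2*c^2 ≠ 0) (_hP : r^2 + a^2 ≠ 0)
    (_hC : x₂^2 = (r^2 + a^2)*(1 - c^2) - x₁^2) (μ ν : Fin 4) :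
    2⁻¹ * ∑ β : Fin 4,
        ginvT a M x₁ x₂ r c 0 β * kT a M x₁ x₂ r c μ ν β = gamT a M x₁ x₂ r c 0 μ ν := by
  fin_cases μ <;> fin_cases ν <;>
    simp only [Fin.sum_univ_four, hT, ellT, kupT, etaT, sgnT, gT, ginvT, drT, dhT, dl1T,
      dl2T, dl3T, dlT, d2rT, d2hT, d2l1T, d2l2T, d2l3T, d2lT, dgT, kzT, d2gT, kT, kT00, kT01, kT02,
          kT03,
      kT11, kT12, kT13, kT22, kT23, kT33, fDfT, dfT, gamT, psiT, Fin.isValue, Fin.reduceEq, if_true,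
      if_false] <;>
    (field_simp <;> ring_nf <;> (try simp only [xp16 _hC, xp15 _hC, xp14 _hC, xp13 _hC, xp12 _hC,
        xp11 _hC,
      xp10 _hC, xp9 _hC, xp8 _hC, xp7 _hC, xp6 _hC, xp5 _hC, xp4 _hC, xp3 _hC,
          _hC]) <;> (try ring_nf))

set_option maxRecDepth 8192 in
set_option maxHeartbeats 8000000 in
/-- The Christoffel symbols `Γ^1_{μν}` of the Kerr metric: `½ ∑_β g^{1β} K(∂_μ, ∂_ν, ∂_β)` equals
the Kerr–Schild closed form. [cite: KerrSchild1965, §3] -/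
theorem gamT_eq_1 (a M x₁ x₂ r c : ℝ) (_hr : r ≠ 0) (_hS : r^2 + a^2*c^2 ≠ 0) (_hP : r^2 + a^2 ≠ 0)
    (_hC : x₂^2 = (r^2 + a^2)*(1 - c^2) - x₁^2) (μ ν : Fin 4) :
    2⁻¹ * ∑ β : Fin 4,
        ginvT a M x₁ x₂ r c 1 β * kT a M x₁ x₂ r c μ ν β = gamT a M x₁ x₂ r c 1 μ ν := by
  fin_cases μ <;> fin_cases ν <;>
    simp only [Fin.sum_univ_four, hT, ellT, kupT, etaT, sgnT, gT, ginvT, drT, dhT, dl1T,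
      dl2T, dl3T, dlT, d2rT, d2hT, d2l1T, d2l2T, d2l3T, d2lT, dgT, kzT, d2gT, kT, kT00, kT01, kT02,
          kT03,
      kT11, kT12, kT13, kT22, kT23, kT33, fDfT, dfT, gamT, psiT, Fin.isValue, Fin.reduceEq, if_true,
      if_false] <;>
    (field_simp <;> ring_nf <;> (try simp only [xp16 _hC, xp15 _hC, xp14 _hC, xp13 _hC, xp12 _hC,
        xp11 _hC,
      xp10 _hC, xp9 _hC, xp8 _hC, xp7 _hC, xp6 _hC, xp5 _hC, xp4 _hC, xp3 _hC,
          _hC]) <;> (try ring_nf))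

set_option maxRecDepth 8192 in
set_option maxHeartbeats 8000000 in
/-- The Christoffel symbols `Γ^2_{μν}` of the Kerr metric: `½ ∑_β g^{2β} K(∂_μ, ∂_ν, ∂_β)` equals
the Kerr–Schild closed form. [cite: KerrSchild1965, §3] -/
theorem gamT_eq_2 (a M x₁ x₂ r c : ℝ) (_hr : r ≠ 0) (_hS : r^2 + a^2*c^2 ≠ 0) (_hP : r^2 + a^2 ≠ 0)
    (_hC : x₂^2 = (r^2 + a^2)*(1 - c^2) - x₁^2) (μ ν : Fin 4) :
    2⁻¹ * ∑ β : Fin 4,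
        ginvT a M x₁ x₂ r c 2 β * kT a M x₁ x₂ r c μ ν β = gamT a M x₁ x₂ r c 2 μ ν := by
  fin_cases μ <;> fin_cases ν <;>
    simp only [Fin.sum_univ_four, hT, ellT, kupT, etaT, sgnT, gT, ginvT, drT, dhT, dl1T,
      dl2T, dl3T, dlT, d2rT, d2hT, d2l1T, d2l2T, d2l3T, d2lT, dgT, kzT, d2gT, kT, kT00, kT01, kT02,
          kT03,
      kT11, kT12, kT13, kT22, kT23, kT33, fDfT, dfT, gamT, psiT, Fin.isValue, Fin.reduceEq, if_true,
      if_false] <;>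
    (field_simp <;> ring_nf <;> (try simp only [xp16 _hC, xp15 _hC, xp14 _hC, xp13 _hC, xp12 _hC,
        xp11 _hC,
      xp10 _hC, xp9 _hC, xp8 _hC, xp7 _hC, xp6 _hC, xp5 _hC, xp4 _hC, xp3 _hC,
          _hC]) <;> (try ring_nf))

set_option maxRecDepth 8192 in
set_option maxHeartbeats 8000000 in
/-- The Christoffel symbols `Γ^3_{μν}` of the Kerr metric: `½ ∑_β g^{3β} K(∂_μ, ∂_ν, ∂_β)` equals
the Kerr–Schild closed form. [cite: KerrSchild1965, §3] -/
theorem gamT_eq_3 (a M x₁ x₂ r c : ℝ) (_hr : r ≠ 0) (_hS : r^2 + a^2*c^2 ≠ 0) (_hP : r^2 + a^2 ≠ 0)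
    (_hC : x₂^2 = (r^2 + a^2)*(1 - c^2) - x₁^2) (μ ν : Fin 4) :
    2⁻¹ * ∑ β : Fin 4,
        ginvT a M x₁ x₂ r c 3 β * kT a M x₁ x₂ r c μ ν β = gamT a M x₁ x₂ r c 3 μ ν := by
  fin_cases μ <;> fin_cases ν <;>
    simp only [Fin.sum_univ_four, hT, ellT, kupT, etaT, sgnT, gT, ginvT, drT, dhT, dl1T,
      dl2T, dl3T, dlT, d2rT, d2hT, d2l1T, d2l2T, d2l3T, d2lT, dgT, kzT, d2gT, kT, kT00, kT01, kT02,
          kT03,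
      kT11, kT12, kT13, kT22, kT23, kT33, fDfT, dfT, gamT, psiT, Fin.isValue, Fin.reduceEq, if_true,
      if_false] <;>
    (field_simp <;> ring_nf <;> (try simp only [xp16 _hC, xp15 _hC, xp14 _hC, xp13 _hC, xp12 _hC,
        xp11 _hC,
      xp10 _hC, xp9 _hC, xp8 _hC, xp7 _hC, xp6 _hC, xp5 _hC, xp4 _hC, xp3 _hC,
          _hC]) <;> (try ring_nf))

/-- **The Christoffel symbols of the Kerr metric**: `½ ∑_β g^{αβ} K(∂_μ, ∂_ν, ∂_β)` equals
the Kerr–Schild closed form `gamT` (uses `ℓ` null and geodesic). [cite: KerrSchild1965, §3] -/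
theorem gamT_eq (a M x₁ x₂ r c : ℝ) (_hr : r ≠ 0) (_hS : r^2 + a^2*c^2 ≠ 0) (_hP : r^2 + a^2 ≠ 0)
    (_hC : x₂^2 = (r^2 + a^2)*(1 - c^2) - x₁^2) (α μ ν : Fin 4) :
    2⁻¹ * ∑ β : Fin 4,
        ginvT a M x₁ x₂ r c α β * kT a M x₁ x₂ r c μ ν β = gamT a M x₁ x₂ r c α μ ν := by
  fin_cases α
  exacts [gamT_eq_0 a M x₁ x₂ r c _hr _hS _hP _hC μ ν, gamT_eq_1 a M x₁ x₂ r c _hr _hS _hP _hC μ ν,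
      gamT_eq_2 a M x₁ x₂ r c _hr _hS _hP _hC μ ν, gamT_eq_3 a M x₁ x₂ r c _hr _hS _hP _hC μ ν]

end StubKerrVacuum

/-- **Registered sub-goal `stub_kerrVacuumKoszul`** of stub `stub_kerrVacuum` (line
`tapered-temporal-collar`): the Koszul form of the Kerr metric in closed form.
[cite: KerrSchild1965, §3] -/
theorem stub_kerrVacuumKoszul : ∀ (a M x₁ x₂ r c : ℝ),
    r ≠ 0 → r ^ 2 + a ^ 2 * c ^ 2 ≠ 0 → r ^ 2 + a ^ 2 ≠ 0 → x₂ ^ 2 = (r ^ 2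
    + a ^ 2) * (1 - c ^ 2) - x₁ ^ 2 → ∀ (μ ν β : Fin 4),
    StubKerrVacuum.kzT a M x₁ x₂ r c μ ν β = StubKerrVacuum.kT a M x₁ x₂ r c μ ν β :=
  fun a M x₁ x₂ r c hr hS hP hC μ ν β ↦ StubKerrVacuum.kzT_eq a M x₁ x₂ r c hr hS hP hC μ ν β

end Summit.FinalStateConjecture.FinalStateConjecture.Theorems.SwallowTheDatum.KerrShieldedSettles
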